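import Literature.NumberTheory.Automorphic.ModularLambdaSurjective
import Literature.NumberTheory.ModularForms.JacobiThetaGammaTwo
import Literature.NumberTheory.EllipticCurves.ModularCurveKleinJ
import Mathlib.NumberTheory.ModularForms.ProperlyDiscontinuous
import Mathlib.Topology.Covering.Quotient
import Mathlib.Topology.Homotopy.Lifting
import Mathlib.Analysis.Complex.OpenMapping
import HarnessLib

/-!
# `λ : ℍ → ℂ ∖ {0, 1}` is a covering map (`Y(2) = Γ(2)\ℍ ≅ ℙ¹ ∖ {0, 1, ∞}`)

F. Calegari, V. Dimitrov, Y. Tang, *The unbounded denominators conjecture*, J. Amer. Math. Soc.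
**38** (2025), 627–702 (arXiv:2109.09040), §1 p. 3, work throughout on "the modular curve
`Y(2) ≅ ℙ¹ ∖ {0, 1, ∞}`", uniformized by Legendre's modular function `λ`: a modular form `f` on
a finite index subgroup is "an algebraic function of `λ`, with branching only at the three
punctures `λ = 0, 1, ∞`", the finite index subgroups `Γ ≤ Γ(2)` are the étale coverings
`Y_Γ = ℍ/Γ → ℍ/Γ(2) = Y(2)`, and (§3, Proposition 15; §5.1) the universal covering of
`Y(2)(ℂ) = ℂ ∖ {0, 1}` by `ℍ` (equivalently by the disc) is the map `λ` itself. This file PROVES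
that classical uniformization statement (Ahlfors, *Complex Analysis*, Ch. 7 §3.4–3.5; it is the
analytic input of Picard's little theorem) for the `λ` of
`Literature/NumberTheory/Automorphic/ModularLambda.lean` (`= θ₂⁴/θ₃⁴`, which is also the
`λ = V/U` of `Literature/NumberTheory/ModularForms/JacobiThetaGammaTwo.lean`,
`modularForms_modularLambda_eq`). Everything is a theorem (no definitions, no named facts):

* `kleinJ_eq_modularLambda` — **`j = 256 (λ² − λ + 1)³ / (λ² (λ − 1)²)`** (from `E₄ = ½(U²+V²+W²)`,
  `Δ = (UVW)²/256`, `U = V + W` of `JacobiThetaGammaTwo` and `kleinJ = E₄³/Δ` of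
  `ModularCurveKleinJ`);
* `sl2_zmod_two_cases`, `mem_Gamma_two_or_modularLambda_smul_eq` — the six elements of
  `SL₂(ℤ/2)` are the reductions of `1, S, T, TS, ST, STS`, so for `g ∈ SL₂(ℤ)` either `g ∈ Γ(2)`
  or `λ(g • z)` is one of the five other anharmonic values `1−λ, 1−(1−λ)⁻¹, 1−λ⁻¹, (1−λ)⁻¹, λ⁻¹`
  (the values themselves, the surjectivity `λ(ℍ) = ℂ ∖ {0,1}` and the open mapping property are
  taken from `ModularLambdaSurjective.lean`);
* `modularLambda_eq_modularLambda_iff` — **`λ(z₁) = λ(z₂) ↔ z₂ ∈ Γ(2) • z₁`**: at generic values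
  from `j(z₁) = j(z₂) ↔ z₂ ∈ SL₂(ℤ) • z₁` (`kleinJ_eq_kleinJ_iff`) and the six values
  (`exists_mem_Gamma_two_smul_eq_of_generic`); at the five elliptic values `½, 2, −1, e^{±iπ/3}`
  by a limiting argument (`exists_mem_Gamma_two_smul_eq`): `λ` is open
  (`isOpenMap_modularLambda_comp_coe`), nearby fibres are generic, and by
  proper discontinuity (Mathlib `properlyDiscontinuousSL2ZRange`, transported to subgroups of
  `SL₂(ℤ)` in `properlyDiscontinuousSMul_subgroup`) only finitely many group elements are in play;
* `mem_closure_T_sq_or_neg_mem`, `entries_of_mem_closure_T_sq`,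
  `eq_one_of_mem_closure_T_sq_of_smul_eq`, `isCancelSMul_closure_T_sq` — `Γ(2) = {±1} · Λ` for the
  free part `Λ = ⟨T², S T² S⁻¹⟩` (Sanov; from the tree's `GammaTwo.Gamma_two_eq_closure`), whose
  elements are `≡ 1 (mod 4)` on the diagonal, so that `Λ` acts freely on `ℍ` (a non-trivial
  element with a fixed point has `|tr| < 2`, while `tr ≡ 2 (mod 4)` on `Λ`);
* **`isQuotientCoveringMap_modularLambda`, `isCoveringMap_modularLambda`,
  `isCoveringMapOn_modularLambda`, `isLocalHomeomorph_modularLambda`** — `λ : ℍ → ℂ ∖ {0,1}` is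
  the quotient covering map of the free, properly discontinuous action of `Λ` (Mathlib
  `IsQuotientMap.isQuotientCoveringMap_of_properlyDiscontinuousSMul`; `λ` is a quotient map
  because it is continuous, open and onto);
* `exists_unique_lift_modularLambda` — continuous maps from simply connected, locally
  path-connected spaces to `ℂ ∖ {0, 1}` lift uniquely through `λ` (Mathlib
  `IsCoveringMap.existsUnique_continuousMap_lifts`).

## References

* [CalegariDimitrovTang2025] F. Calegari, V. Dimitrov, Y. Tang, The unbounded denominators
  conjecture, J. Amer. Math. Soc. 38 (2025), 627–702; arXiv:2109.09040, §1 p. 3 (`Y(2)`, `λ`),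
  §3 Proposition 15, §5.1.
* L. V. Ahlfors, Complex Analysis, 3rd ed., McGraw-Hill (1979), Ch. 7 §3.4 Theorem 7, §3.5
  (the modular function `λ` and the conformal mapping it effects), Ch. 8 §3.4 (Picard).
-/

noncomputable section

open Complex Filter Topology UpperHalfPlane ModularGroup CongruenceSubgroup Matrix.SpecialLinearGroup

open scoped MatrixGroups ModularForm

namespace Literature.NumberTheory.Automorphic

namespace ModularLambda

section LambdaCovering

/-! ## The `λ`–`j` relation -/

/-- The `λ` of `JacobiThetaGammaTwo` (`V/U` on `ℍ`) is this file's `λ` (`θ₂⁴/θ₃⁴` on `ℂ`).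
[folklore] -/
theorem modularForms_modularLambda_eq (τ : ℍ) :
    Literature.NumberTheory.ModularForms.modularLambda τ = modularLambda τ := rfl

open Literature.NumberTheory.EllipticCurves.ModularForms in
/-- **`j = 256 (λ² − λ + 1)³ / (λ² (λ − 1)²)`** on `ℍ`: Klein's invariant as a rational function of
degree `6` of the `λ`-function (from `E₄ = ½(U² + V² + W²)`, `Δ = (UVW)²/256`, `U = V + W`,
`λ = V/U`). [folklore] -/
theorem kleinJ_eq_modularLambda (τ : ℍ) :
    kleinJ τ = 256 * ((modularLambda τ) ^ 2 - modularLambda τ + 1) ^ 3 /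
      ((modularLambda τ) ^ 2 * (modularLambda τ - 1) ^ 2) := by
  have hU := Literature.NumberTheory.ModularForms.thetaU_ne_zero τ
  have hV := Literature.NumberTheory.ModularForms.thetaV_ne_zero τ
  have hW := Literature.NumberTheory.ModularForms.thetaW_ne_zero τ
  have hUVW := Literature.NumberTheory.ModularForms.thetaU_apply_eq τ
  generalize hUdef : Literature.NumberTheory.ModularForms.thetaU τ = U at hU hUVW
  generalize hVdef : Literature.NumberTheory.ModularForms.thetaV τ = V at hV hUVW
  generalize hWdef : Literature.NumberTheory.ModularForms.thetaW τ = W at hW hUVW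
  have hl : modularLambda τ = V / U := by rw [← hUdef, ← hVdef]; rfl
  have hE4 : ModularForm.E₄ τ = V ^ 2 + V * W + W ^ 2 := by
    rw [Literature.NumberTheory.ModularForms.E₄_eq_theta, hUdef, hVdef, hWdef, hUVW]; ring
  have hΔ : ModularForm.discriminant τ = ((V + W) * V * W) ^ 2 / 256 := by
    rw [Literature.NumberTheory.ModularForms.discriminant_eq_theta, hUdef, hVdef, hWdef, hUVW]
  have hVW : V + W ≠ 0 := hUVW ▸ hU
  have h1 : (V / U) ^ 2 - V / U + 1 = (V ^ 2 + V * W + W ^ 2) / (V + W) ^ 2 := by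
    rw [hUVW]; field_simp; ring
  have h2 : (V / U) ^ 2 * (V / U - 1) ^ 2 = (V * W) ^ 2 / (V + W) ^ 4 := by
    rw [hUVW]; field_simp; ring
  rw [kleinJ, hE4, hΔ, hl, h1, h2]
  field_simp

/-! ## Reduction modulo `Γ(2)` -/

/-- The six elements of `SL₂(ℤ/2ℤ)` are the reductions of `1, S, T, TS, ST, STS`. [folklore] -/
theorem sl2_zmod_two_cases (x : SL(2, ZMod 2)) :
    x = 1 ∨ x = map (Int.castRingHom (ZMod 2)) S ∨ x = map (Int.castRingHom (ZMod 2)) T ∨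
      x = map (Int.castRingHom (ZMod 2)) (T * S) ∨ x = map (Int.castRingHom (ZMod 2)) (S * T) ∨
      x = map (Int.castRingHom (ZMod 2)) (S * T * S) := by
  have h2 : ∀ u : ZMod 2, u = 0 ∨ u = 1 := by decide
  have hdet : x 0 0 * x 1 1 - x 0 1 * x 1 0 = 1 := by
    have := x.2
    rwa [Matrix.det_fin_two] at this
  have hS : (map (Int.castRingHom (ZMod 2)) S : Matrix (Fin 2) (Fin 2) (ZMod 2)) = !![0, 1; 1, 0] := by
    ext i j
    fin_cases i <;> fin_cases j <;> simp [ModularGroup.coe_S]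
  have hT : (map (Int.castRingHom (ZMod 2)) T : Matrix (Fin 2) (Fin 2) (ZMod 2)) = !![1, 1; 0, 1] := by
    ext i j
    fin_cases i <;> fin_cases j <;> simp [ModularGroup.coe_T]
  have hTS : (map (Int.castRingHom (ZMod 2)) (T * S) : Matrix (Fin 2) (Fin 2) (ZMod 2)) =
      !![1, 1; 1, 0] := by
    rw [map_mul, coe_mul, hS, hT]
    ext i j
    fin_cases i <;> fin_cases j <;> simp [Matrix.mul_apply, Fin.sum_univ_two] 
  have hST : (map (Int.castRingHom (ZMod 2)) (S * T) : Matrix (Fin 2) (Fin 2) (ZMod 2)) =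
      !![0, 1; 1, 1] := by
    rw [map_mul, coe_mul, hS, hT]
    ext i j
    fin_cases i <;> fin_cases j <;> simp [Matrix.mul_apply, Fin.sum_univ_two]
  have hSTS : (map (Int.castRingHom (ZMod 2)) (S * T * S) : Matrix (Fin 2) (Fin 2) (ZMod 2)) =
      !![1, 0; 1, 1] := by
    rw [map_mul, coe_mul, hST, hS]
    ext i j
    fin_cases i <;> fin_cases j <;> simp [Matrix.mul_apply, Fin.sum_univ_two]
  simp only [Matrix.SpecialLinearGroup.ext_iff, Fin.forall_fin_two, hS, hT, hTS, hST, hSTS,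
    Matrix.SpecialLinearGroup.coe_one, Matrix.one_apply_eq, Matrix.one_apply_ne, ne_eq,
    zero_ne_one, one_ne_zero, not_false_eq_true, Matrix.of_apply, Matrix.cons_val',
    Matrix.cons_val_zero, Matrix.cons_val_one, Matrix.empty_val', Matrix.cons_val_fin_one]
  rcases h2 (x 0 0) with ha | ha <;> rcases h2 (x 0 1) with hb | hb <;>
    rcases h2 (x 1 0) with hc | hc <;> rcases h2 (x 1 1) with hd | hd <;>
    simp only [ha, hb, hc, hd] at hdet ⊢ <;> revert hdet <;> decide

/-- **`λ` on `SL₂(ℤ) • z`.** For every `g ∈ SL₂(ℤ)` either `g ∈ Γ(2)` (and `λ(g • z) = λ(z)`), or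
`λ(g • z)` is one of the five other anharmonic transforms `1 − λ, λ/(λ−1), (λ−1)/λ, 1/(1−λ), 1/λ`
of `λ = λ(z)`, according to the coset of `g` modulo `Γ(2)` (`SL₂(ℤ)/Γ(2) ≅ SL₂(ℤ/2) ≅ S₃`).
[folklore] -/
theorem mem_Gamma_two_or_modularLambda_smul_eq (g : SL(2, ℤ)) (z : ℍ) :
    g ∈ CongruenceSubgroup.Gamma 2 ∨
      modularLambda ((g • z : ℍ) : ℂ) = 1 - modularLambda z ∨
      modularLambda ((g • z : ℍ) : ℂ) = 1 - (1 - modularLambda z)⁻¹ ∨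
      modularLambda ((g • z : ℍ) : ℂ) = 1 - (modularLambda z)⁻¹ ∨
      modularLambda ((g • z : ℍ) : ℂ) = (1 - modularLambda z)⁻¹ ∨
      modularLambda ((g • z : ℍ) : ℂ) = (modularLambda z)⁻¹ := by
  -- `g r⁻¹ ∈ Γ(2)` for the representative `r` with the same reduction mod `2`
  have key : ∀ r : SL(2, ℤ), map (Int.castRingHom (ZMod 2)) g = map (Int.castRingHom (ZMod 2)) r →
      modularLambda ((g • z : ℍ) : ℂ) = modularLambda ((r • z : ℍ) : ℂ) := by
    intro r hr
    have hmem : g * r⁻¹ ∈ CongruenceSubgroup.Gamma 2 := by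
      rw [Gamma_mem', map_mul, map_inv, hr, mul_inv_cancel]
    have := modularLambda_smul hmem (r • z)
    rwa [← mul_smul, inv_mul_cancel_right] at this
  rcases sl2_zmod_two_cases (map (Int.castRingHom (ZMod 2)) g) with h | h | h | h | h | h
  · exact Or.inl (Gamma_mem'.mpr h)
  · exact Or.inr <| Or.inl <| (key _ h).trans (modularLambda_S_smul z)
  · exact Or.inr <| Or.inr <| Or.inl <| (key _ h).trans (modularLambda_T_smul z)
  · exact Or.inr <| Or.inr <| Or.inr <| Or.inl <| (key _ h).trans (modularLambda_TS_smul z)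
  · exact Or.inr <| Or.inr <| Or.inr <| Or.inr <| Or.inl <|
      (key _ h).trans (modularLambda_ST_smul z)
  · exact Or.inr <| Or.inr <| Or.inr <| Or.inr <| Or.inr <|
      (key _ h).trans (modularLambda_STS_smul z)

open Literature.NumberTheory.EllipticCurves.ModularForms in
/-- **The fibres of `λ` away from the elliptic values.** If `λ(z₁) = λ(z₂)` and `c = λ(z₁)` is
none of the five values `½, 2, −1, e^{±iπ/3}` fixed by a non-trivial anharmonic substitution, then
`z₂ ∈ Γ(2) • z₁` (from `j(z₁) = j(z₂)`, i.e. `z₂ ∈ SL₂(ℤ) • z₁`, and the previous theorem).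
[folklore] -/
theorem exists_mem_Gamma_two_smul_eq_of_generic {z₁ z₂ : ℍ}
    (h : modularLambda (z₁ : ℂ) = modularLambda (z₂ : ℂ))
    (h₁ : modularLambda (z₁ : ℂ) ≠ 1 / 2) (h₂ : modularLambda (z₁ : ℂ) ≠ 2)
    (h₃ : modularLambda (z₁ : ℂ) ≠ -1)
    (h₄ : modularLambda (z₁ : ℂ) ^ 2 - modularLambda (z₁ : ℂ) + 1 ≠ 0) :
    ∃ γ ∈ CongruenceSubgroup.Gamma 2, γ • z₁ = z₂ := by
  have hj : kleinJ z₁ = kleinJ z₂ := by rw [kleinJ_eq_modularLambda, kleinJ_eq_modularLambda, h]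
  obtain ⟨g, rfl⟩ := kleinJ_eq_kleinJ_iff.mp hj
  have h0 := modularLambda_ne_zero z₁.2
  have h1 : modularLambda (z₁ : ℂ) - 1 ≠ 0 := sub_ne_zero.mpr (modularLambda_ne_one z₁.2)
  have h1' : 1 - modularLambda (z₁ : ℂ) ≠ 0 := sub_ne_zero.mpr (modularLambda_ne_one z₁.2).symm
  rcases mem_Gamma_two_or_modularLambda_smul_eq g z₁ with hg | hg | hg | hg | hg | hg
  · exact ⟨g, hg, rfl⟩
  all_goals exfalso; rw [← h] at hg
  · -- `c = 1 - c`
    exact h₁ (by linear_combination (1 / 2 : ℂ) * hg)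
  · -- `c = 1 - (1 - c)⁻¹`, i.e. `c = 2`
    have : (1 - modularLambda (z₁ : ℂ)) * (1 - modularLambda (z₁ : ℂ)) = 1 := by
      have h' : 1 - modularLambda (z₁ : ℂ) = (1 - modularLambda (z₁ : ℂ))⁻¹ := by
        linear_combination -hg
      nth_rw 2 [h']
      exact mul_inv_cancel₀ h1'
    have hsq : (modularLambda (z₁ : ℂ) - 2) * modularLambda (z₁ : ℂ) = 0 := by
      linear_combination this
    rcases mul_eq_zero.mp hsq with h' | h'
    · exact h₂ (by linear_combination h')
    · exact h0 h'
  · -- `c = 1 - c⁻¹`, i.e. `c² - c + 1 = 0`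
    have : modularLambda (z₁ : ℂ) * modularLambda (z₁ : ℂ) = modularLambda (z₁ : ℂ) - 1 := by
      have h' := congrArg (· * modularLambda (z₁ : ℂ)) hg
      simp only [sub_mul, inv_mul_cancel₀ h0, one_mul] at h'
      exact h'
    exact h₄ (by linear_combination this)
  · -- `c = (1 - c)⁻¹`, i.e. `c² - c + 1 = 0`
    have : modularLambda (z₁ : ℂ) * (1 - modularLambda (z₁ : ℂ)) = 1 := by
      have h' := congrArg (· * (1 - modularLambda (z₁ : ℂ))) hg
      simp only [inv_mul_cancel₀ h1'] at h'
      exact h'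
    exact h₄ (by linear_combination -this)
  · -- `c = c⁻¹`, i.e. `c = ±1`
    have : modularLambda (z₁ : ℂ) * modularLambda (z₁ : ℂ) = 1 := by
      have h' := congrArg (· * modularLambda (z₁ : ℂ)) hg
      simp only [inv_mul_cancel₀ h0] at h'
      exact h'
    have hsq : (modularLambda (z₁ : ℂ) + 1) * (modularLambda (z₁ : ℂ) - 1) = 0 := by
      linear_combination this
    rcases mul_eq_zero.mp hsq with h' | h'
    · exact h₃ (by linear_combination h')
    · exact h1 h'

/-! ## `λ` is continuous and open on `ℍ` -/

/-- `z ↦ λ(z)` is continuous on `ℍ`. [folklore] -/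
theorem continuous_modularLambda_comp_coe : Continuous fun z : ℍ ↦ modularLambda (z : ℂ) :=
  continuous_iff_continuousAt.mpr fun z ↦
    (differentiableAt_modularLambda z.2).continuousAt.comp continuous_coe.continuousAt

/-- **`λ` is an open map on `ℍ`** (open mapping theorem, `isOpen_image_modularLambda`).
[folklore] -/
theorem isOpenMap_modularLambda_comp_coe : IsOpenMap fun z : ℍ ↦ modularLambda (z : ℂ) := by
  intro s hs
  have : (fun z : ℍ ↦ modularLambda (z : ℂ)) '' s = modularLambda '' (((↑) : ℍ → ℂ) '' s) := by
    rw [Set.image_image]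
  rw [this]
  exact isOpen_image_modularLambda (by rintro w ⟨z, -, rfl⟩; exact z.2)
    (isOpenEmbedding_coe.isOpenMap s hs)

/-- Every subgroup of `SL₂(ℤ)` acts properly discontinuously on `ℍ` (Mathlib: the image of `SL₂(ℤ)`
in `GL₂(ℝ)` does). [folklore] -/
theorem properlyDiscontinuousSMul_subgroup (Λ : Subgroup SL(2, ℤ)) :
    ProperlyDiscontinuousSMul Λ ℍ := by
  constructor
  intro K L hK hL
  have hfin := (properlyDiscontinuousSL2ZRange).finite_disjoint_inter_image hK hL
  let ι : Λ → (Matrix.SpecialLinearGroup.mapGL ℝ : SL(2, ℤ) →* GL (Fin 2) ℝ).range :=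
    fun γ ↦ ⟨Matrix.SpecialLinearGroup.mapGL ℝ (γ : SL(2, ℤ)), γ, rfl⟩
  have hι : Function.Injective ι := by
    intro γ γ' h
    have h' : (Matrix.SpecialLinearGroup.mapGL ℝ (γ : SL(2, ℤ)) : GL (Fin 2) ℝ) =
        Matrix.SpecialLinearGroup.mapGL ℝ (γ' : SL(2, ℤ)) := congrArg Subtype.val h
    refine Subtype.ext (Matrix.SpecialLinearGroup.ext _ _ fun i j ↦ ?_)
    have := congrArg (fun g : GL (Fin 2) ℝ ↦ (g : Matrix (Fin 2) (Fin 2) ℝ) i j) h'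
    simpa using this
  have hset : {γ : Λ | ((fun x : ℍ ↦ γ • x) '' K ∩ L).Nonempty} =
      ι ⁻¹' {g | ((fun x : ℍ ↦ g • x) '' K ∩ L).Nonempty} := by
    ext γ
    rfl
  rw [hset]
  exact hfin.preimage hι.injOn

/-! ## The free part `Λ = ⟨T², S T² S⁻¹⟩` of `Γ(2) = {±1} · Λ` -/

/-- `⟨T², S T² S⁻¹⟩ ≤ Γ(2)`. [folklore] -/
theorem closure_T_sq_le_Gamma_two :
    Subgroup.closure ({T ^ 2, S * T ^ 2 * S⁻¹} : Set SL(2, ℤ)) ≤ CongruenceSubgroup.Gamma 2 := by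
  rw [GammaTwo.Gamma_two_eq_closure]
  exact Subgroup.closure_mono fun x hx ↦ by
    simp only [Set.mem_insert_iff, Set.mem_singleton_iff] at hx ⊢
    tauto

/-- `Γ(2) = Λ ∪ (−1)Λ` for `Λ = ⟨T², S T² S⁻¹⟩` (since `Γ(2) = ⟨T², S T² S⁻¹, −1⟩` and `−1` is
central). [folklore] -/
theorem mem_closure_T_sq_or_neg_mem {γ : SL(2, ℤ)} (hγ : γ ∈ CongruenceSubgroup.Gamma 2) :
    γ ∈ Subgroup.closure ({T ^ 2, S * T ^ 2 * S⁻¹} : Set SL(2, ℤ)) ∨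
      -γ ∈ Subgroup.closure ({T ^ 2, S * T ^ 2 * S⁻¹} : Set SL(2, ℤ)) := by
  set Λ := Subgroup.closure ({T ^ 2, S * T ^ 2 * S⁻¹} : Set SL(2, ℤ)) with hΛ
  rw [GammaTwo.Gamma_two_eq_closure] at hγ
  induction hγ using Subgroup.closure_induction with
  | mem x hx =>
    rcases hx with rfl | rfl | rfl
    · exact Or.inl (Subgroup.subset_closure (by simp))
    · exact Or.inl (Subgroup.subset_closure (by simp))
    · exact Or.inr (by rw [neg_neg]; exact one_mem _)
  | one => exact Or.inl (one_mem _)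
  | mul x y _ _ hx hy =>
    rcases hx with hx | hx <;> rcases hy with hy | hy
    · exact Or.inl (mul_mem hx hy)
    · exact Or.inr (by rw [← mul_neg]; exact mul_mem hx hy)
    · exact Or.inr (by rw [← neg_mul]; exact mul_mem hx hy)
    · exact Or.inl (by rw [← neg_mul_neg]; exact mul_mem hx hy)
  | inv x _ hx =>
    rcases hx with hx | hx
    · exact Or.inl (inv_mem hx)
    · refine Or.inr ?_
      have : (-x)⁻¹ = -x⁻¹ := inv_eq_of_mul_eq_one_right (by rw [neg_mul_neg, mul_inv_cancel])
      rw [← this]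
      exact inv_mem hx

/-- The elements of `Λ = ⟨T², S T² S⁻¹⟩` are `≡ 1 (mod 4)` on the diagonal and even off it.
[folklore] -/
theorem entries_of_mem_closure_T_sq {γ : SL(2, ℤ)}
    (hγ : γ ∈ Subgroup.closure ({T ^ 2, S * T ^ 2 * S⁻¹} : Set SL(2, ℤ))) :
    (4 : ℤ) ∣ γ 0 0 - 1 ∧ (4 : ℤ) ∣ γ 1 1 - 1 ∧ (2 : ℤ) ∣ γ 0 1 ∧ (2 : ℤ) ∣ γ 1 0 := by
  induction hγ using Subgroup.closure_induction with
  | mem x hx =>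
    rcases hx with rfl | rfl
    · have h : ((T ^ 2 : SL(2, ℤ)) : Matrix (Fin 2) (Fin 2) ℤ) = !![1, 2; 0, 1] := by
        rw [show (T ^ 2 : SL(2, ℤ)) = T ^ (2 : ℤ) from (zpow_natCast T 2).symm,
          ModularGroup.coe_T_zpow]
      simp [h]
    · have h : ((S * T ^ 2 * S⁻¹ : SL(2, ℤ)) : Matrix (Fin 2) (Fin 2) ℤ) = !![1, 0; -2, 1] := by
        rw [show (T ^ 2 : SL(2, ℤ)) = T ^ (2 : ℤ) from (zpow_natCast T 2).symm]
        exact GammaTwo.coe_S_mul_T_zpow_mul_S_inv 2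
      simp [h]
  | one => simp
  | mul x y _ _ hx hy =>
    obtain ⟨hx00, hx11, hx01, hx10⟩ := hx
    obtain ⟨hy00, hy11, hy01, hy10⟩ := hy
    simp only [Matrix.SpecialLinearGroup.coe_mul, Matrix.mul_apply, Fin.sum_univ_two]
    refine ⟨?_, ?_, ?_, ?_⟩
    · have : x 0 0 * y 0 0 + x 0 1 * y 1 0 - 1 = x 0 0 * (y 0 0 - 1) + (x 0 0 - 1) + x 0 1 * y 1 0 := by
        ring
      rw [this]
      exact dvd_add (dvd_add (dvd_mul_of_dvd_right hy00 _) hx00)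
        (by simpa using mul_dvd_mul hx01 hy10)
    · have : x 1 0 * y 0 1 + x 1 1 * y 1 1 - 1 = x 1 0 * y 0 1 + x 1 1 * (y 1 1 - 1) + (x 1 1 - 1) := by
        ring
      rw [this]
      exact dvd_add (dvd_add (by simpa using mul_dvd_mul hx10 hy01) (dvd_mul_of_dvd_right hy11 _))
        hx11
    · exact dvd_add (dvd_mul_of_dvd_right hy01 _) (dvd_mul_of_dvd_left hx01 _)
    · exact dvd_add (dvd_mul_of_dvd_left hx10 _) (dvd_mul_of_dvd_right hy10 _)
  | inv x _ hx =>
    obtain ⟨hx00, hx11, hx01, hx10⟩ := hx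
    simp only [Matrix.SpecialLinearGroup.coe_inv, Matrix.adjugate_fin_two, Matrix.of_apply,
      Matrix.cons_val', Matrix.cons_val_zero, Matrix.cons_val_one, Matrix.empty_val',
      Matrix.cons_val_fin_one, dvd_neg]
    exact ⟨hx11, hx00, hx01, hx10⟩

/-- **`Λ = ⟨T², S T² S⁻¹⟩` acts freely on `ℍ`**: an element of `Λ` with a fixed point is `1`
(an elliptic or central element `±1 ≠ γ ∈ SL₂(ℤ)` with a fixed point has `|tr γ| < 2`, while
`tr γ ≡ 2 (mod 4)` on `Λ`). [folklore] -/
theorem eq_one_of_mem_closure_T_sq_of_smul_eq {γ : SL(2, ℤ)}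
    (hγ : γ ∈ Subgroup.closure ({T ^ 2, S * T ^ 2 * S⁻¹} : Set SL(2, ℤ))) {z : ℍ}
    (h : γ • z = z) : γ = 1 := by
  obtain ⟨h00, h11, h01, h10⟩ := entries_of_mem_closure_T_sq hγ
  have hdet : γ 0 0 * γ 1 1 - γ 0 1 * γ 1 0 = 1 := by
    have := Matrix.SpecialLinearGroup.det_coe γ
    rwa [Matrix.det_fin_two] at this
  -- the fixed-point equation in `ℂ`
  have hE : ((γ 0 0 : ℤ) : ℂ) * z + (γ 0 1 : ℤ) = (z : ℂ) * ((γ 1 0 : ℤ) * z + (γ 1 1 : ℤ)) := by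
    have h' := congrArg UpperHalfPlane.coe h
    rw [specialLinearGroup_apply] at h'
    simp only [algebraMap_int_eq, Int.coe_castRingHom, Complex.ofReal_intCast] at h'
    have hden : ((γ 1 0 : ℤ) : ℂ) * z + (γ 1 1 : ℤ) ≠ 0 := by
      intro h0
      have him := congrArg Complex.im h0
      simp only [Complex.add_im, Complex.mul_im, Complex.intCast_re, Complex.intCast_im,
        zero_mul, add_zero, Complex.zero_im] at him
      have hc : (γ 1 0 : ℤ) = 0 := by
        have := mul_eq_zero.mp him
        rcases this with h | h
        · exact_mod_cast h
        · exact absurd h z.im_pos.ne'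
      rw [hc, Int.cast_zero, zero_mul, zero_add] at h0
      have hd : (γ 1 1 : ℤ) = 0 := by exact_mod_cast h0
      rw [hc, hd, mul_zero, mul_zero, sub_zero] at hdet
      exact zero_ne_one hdet
    rwa [div_eq_iff hden] at h'
  -- real and imaginary parts
  set a : ℤ := γ 0 0
  set b : ℤ := γ 0 1
  set c : ℤ := γ 1 0
  set d : ℤ := γ 1 1
  set x : ℝ := (z : ℂ).re
  set y : ℝ := (z : ℂ).im
  have hy : 0 < y := z.im_pos
  have hre := congrArg Complex.re hE
  have him := congrArg Complex.im hE
  simp only [Complex.add_re, Complex.mul_re, Complex.intCast_re, Complex.intCast_im, zero_mul,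
    sub_zero, Complex.add_im, Complex.mul_im, add_zero] at hre him
  -- hre : a x + b = x (c x + d) - y (c y) ; him : a y = x (c y) + y (c x + d)
  have had : (a : ℝ) - d = 2 * c * x := by
    have : ((a : ℝ) - d - 2 * c * x) * y = 0 := by linear_combination him
    rcases mul_eq_zero.mp this with h | h
    · linear_combination h
    · exact absurd h hy.ne'
  have hb : (b : ℝ) = -c * (x ^ 2 + y ^ 2) := by linear_combination hre - x * had
  have hdetR : (a : ℝ) * d - b * c = 1 := by exact_mod_cast hdet
  have htr : ((a : ℝ) + d) ^ 2 = 4 - 4 * c ^ 2 * y ^ 2 := by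
    linear_combination ((a : ℝ) - d + 2 * c * x) * had + 4 * hdetR + 4 * (c : ℝ) * hb
  by_cases hc : c = 0
  · -- `c = 0`: `a = d = ±1`, hence `a = d = 1`, and `b = 0`
    have had' : a = d := by
      have : (a : ℝ) = d := by rw [hc] at had; push_cast at had; linarith
      exact_mod_cast this
    have hb' : b = 0 := by
      have : (b : ℝ) = 0 := by rw [hb, hc]; push_cast; ring
      exact_mod_cast this
    have ha1 : a = 1 := by
      rw [← had', hb', zero_mul, sub_zero] at hdet
      -- `a * a = 1` and `4 ∣ a - 1`
      have ha : a = 1 ∨ a = -1 := by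
        have := Int.eq_one_or_neg_one_of_mul_eq_one hdet
        exact this
      rcases ha with ha | ha
      · exact ha
      · exfalso; rw [ha] at h00; norm_num at h00
    ext i j
    fin_cases i <;> fin_cases j
    · simpa using ha1
    · simpa using hb'
    · simpa using hc
    · simpa using (had'.symm.trans ha1)
  · exfalso
    have hlt : ((a : ℝ) + d) ^ 2 < 4 := by
      rw [htr]
      have : 0 < (c : ℝ) ^ 2 * y ^ 2 := by
        have hc' : (c : ℝ) ≠ 0 := by exact_mod_cast hc
        positivity
      linarith
    have hlt' : (a + d) ^ 2 < 4 := by exact_mod_cast hlt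
    obtain ⟨p, hp⟩ := h00
    obtain ⟨q, hq⟩ := h11
    have hs : a + d = 4 * (p + q) + 2 := by linarith
    rw [hs] at hlt'
    rcases le_or_gt 0 (p + q) with hpq | hpq
    · nlinarith
    · nlinarith

/-- `Λ = ⟨T², S T² S⁻¹⟩` acts freely on `ℍ`. [folklore] -/
theorem isCancelSMul_closure_T_sq :
    IsCancelSMul (Subgroup.closure ({T ^ 2, S * T ^ 2 * S⁻¹} : Set SL(2, ℤ))) ℍ :=
  isCancelSMul_iff_eq_one_of_smul_eq.mpr fun γ _ h ↦
    Subtype.ext (eq_one_of_mem_closure_T_sq_of_smul_eq γ.2 h)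


/-! ## All fibres of `λ` are `Γ(2)`-orbits -/

/-- The roots of `x² − x + 1`. [folklore] -/
theorem sq_sub_add_one_eq_zero_iff (w : ℂ) :
    w ^ 2 - w + 1 = 0 ↔ w = (1 + Complex.I * Real.sqrt 3) / 2 ∨ w = (1 - Complex.I * Real.sqrt 3) / 2 := by
  have hs : ((Real.sqrt 3 : ℝ) : ℂ) ^ 2 = 3 := by
    rw [← Complex.ofReal_pow, Real.sq_sqrt (by norm_num)]; norm_num
  have hfac : w ^ 2 - w + 1 =
      (w - (1 + Complex.I * Real.sqrt 3) / 2) * (w - (1 - Complex.I * Real.sqrt 3) / 2) := by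
    linear_combination (((Real.sqrt 3 : ℝ) : ℂ) ^ 2 / 4) * Complex.I_sq + (-1 / 4 : ℂ) * hs
  rw [hfac, mul_eq_zero, sub_eq_zero, sub_eq_zero]

/-- **`λ(z₁) = λ(z₂) ↔ z₂ ∈ Γ(2) • z₁`** — the fibres of `λ` are exactly the `Γ(2)`-orbits, at the
elliptic values too (from the generic case by openness of `λ` and proper discontinuity: near a bad
fibre there are generic fibres, which are single orbits, and only finitely many group elements
move a compact neighbourhood of `z₁` near `z₂`). [folklore] -/
theorem exists_mem_Gamma_two_smul_eq {z₁ z₂ : ℍ}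
    (h : modularLambda (z₁ : ℂ) = modularLambda (z₂ : ℂ)) :
    ∃ γ ∈ CongruenceSubgroup.Gamma 2, γ • z₁ = z₂ := by
  by_contra hne
  simp only [not_exists, not_and] at hne
  haveI := properlyDiscontinuousSMul_subgroup (CongruenceSubgroup.Gamma 2)
  obtain ⟨K₁, hK₁, hK₁z⟩ := exists_compact_mem_nhds z₁
  obtain ⟨K₂, hK₂, hK₂z⟩ := exists_compact_mem_nhds z₂
  have hfin := ProperlyDiscontinuousSMul.finite_disjoint_inter_image
    (Γ := CongruenceSubgroup.Gamma 2) hK₁ hK₂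
  -- separate `γ • z₁ ≠ z₂` for the finitely many relevant `γ`
  have hsep : ∀ γ : CongruenceSubgroup.Gamma 2, ∃ A B : Set ℍ, IsOpen A ∧ IsOpen B ∧
      (γ : SL(2, ℤ)) • z₁ ∈ A ∧ z₂ ∈ B ∧ Disjoint A B :=
    fun γ ↦ t2_separation (hne γ γ.2)
  choose A B hA hB hzA hzB hAB using hsep
  set U : Set ℍ := interior K₁ ∩ ⋂ γ ∈ hfin.toFinset, (fun z : ℍ ↦ (γ : SL(2, ℤ)) • z) ⁻¹' A γ
    with hUdef
  set V : Set ℍ := interior K₂ ∩ ⋂ γ ∈ hfin.toFinset, B γ with hVdef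
  have hU : IsOpen U := isOpen_interior.inter (isOpen_biInter_finset fun γ _ ↦
    (hA γ).preimage (continuous_const_smul
      ((Matrix.SpecialLinearGroup.mapGL ℝ ((γ : SL(2, ℤ))) : GL (Fin 2) ℝ))))
  have hV : IsOpen V := isOpen_interior.inter (isOpen_biInter_finset fun γ _ ↦ hB γ)
  have hz₁U : z₁ ∈ U :=
    ⟨mem_interior_iff_mem_nhds.mpr hK₁z, Set.mem_iInter₂.mpr fun γ _ ↦ hzA γ⟩
  have hz₂V : z₂ ∈ V :=
    ⟨mem_interior_iff_mem_nhds.mpr hK₂z, Set.mem_iInter₂.mpr fun γ _ ↦ hzB γ⟩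
  -- no element of `Γ(2)` moves a point of `U` into `V`
  have hUV : ∀ γ : CongruenceSubgroup.Gamma 2, ∀ u ∈ U, (γ : SL(2, ℤ)) • u ∉ V := by
    intro γ u hu hv
    by_cases hγ : γ ∈ hfin.toFinset
    · exact Set.disjoint_left.mp (hAB γ) (Set.mem_iInter₂.mp hu.2 γ hγ)
        (Set.mem_iInter₂.mp hv.2 γ hγ)
    · refine hγ (hfin.mem_toFinset.mpr ⟨(γ : SL(2, ℤ)) • u, ⟨u, interior_subset hu.1, rfl⟩,
        interior_subset hv.1⟩)
  -- `λ(U) ∩ λ(V)` is an open neighbourhood of `c = λ(z₁) = λ(z₂)`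
  have hO : IsOpen ((fun z : ℍ ↦ modularLambda (z : ℂ)) '' U ∩
      (fun z : ℍ ↦ modularLambda (z : ℂ)) '' V) :=
    (isOpenMap_modularLambda_comp_coe U hU).inter (isOpenMap_modularLambda_comp_coe V hV)
  obtain ⟨ε, hε, hball⟩ := Metric.isOpen_iff.mp hO (modularLambda (z₁ : ℂ))
    ⟨⟨z₁, hz₁U, rfl⟩, ⟨z₂, hz₂V, h.symm⟩⟩
  -- a generic value `c + t` in it
  set E : Set ℂ := {1 / 2, 2, -1, (1 + Complex.I * Real.sqrt 3) / 2,
    (1 - Complex.I * Real.sqrt 3) / 2} with hE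
  have hEfin : E.Finite := Set.toFinite E
  have hbad : {t : ℝ | modularLambda (z₁ : ℂ) + t ∈ E}.Finite :=
    hEfin.preimage ((add_right_injective _).comp Complex.ofReal_injective).injOn
  obtain ⟨t, ⟨ht0, htε⟩, htE⟩ := (Set.Ioo_infinite hε).exists_notMem_finite hbad
  have hmem : modularLambda (z₁ : ℂ) + t ∈ Metric.ball (modularLambda (z₁ : ℂ)) ε := by
    rw [Metric.mem_ball, dist_self_add_left, Complex.norm_real, Real.norm_eq_abs, abs_of_pos ht0]
    exact htε
  obtain ⟨⟨u, hu, hu'⟩, ⟨v, hv, hv'⟩⟩ := hball hmem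
  have hu'' : modularLambda (u : ℂ) = modularLambda (z₁ : ℂ) + t := hu'
  have hgen : modularLambda (u : ℂ) ∉ E := by rw [hu'']; exact htE
  simp only [hE, Set.mem_insert_iff, Set.mem_singleton_iff, not_or] at hgen
  obtain ⟨g1, g2, g3, g4, g5⟩ := hgen
  have g45 : modularLambda (u : ℂ) ^ 2 - modularLambda (u : ℂ) + 1 ≠ 0 := fun h0 ↦ by
    rcases (sq_sub_add_one_eq_zero_iff _).mp h0 with h' | h'
    · exact g4 h'
    · exact g5 h'
  obtain ⟨γ, hγ, hγuv⟩ := exists_mem_Gamma_two_smul_eq_of_generic (hu'.trans hv'.symm) g1 g2 g3 g45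
  exact hUV ⟨γ, hγ⟩ u hu (hγuv ▸ hv)

/-- **The fibres of `λ` are the `Γ(2)`-orbits.** [cite: CalegariDimitrovTang2025, §1 p. 3] -/
theorem modularLambda_eq_modularLambda_iff {z₁ z₂ : ℍ} :
    modularLambda (z₁ : ℂ) = modularLambda (z₂ : ℂ) ↔
      ∃ γ ∈ CongruenceSubgroup.Gamma 2, γ • z₁ = z₂ :=
  ⟨exists_mem_Gamma_two_smul_eq, fun ⟨_, hγ, h⟩ ↦ h ▸ (modularLambda_smul hγ z₁).symm⟩

/-- The fibres of `λ` are the orbits of the free part `Λ = ⟨T², S T² S⁻¹⟩` of `Γ(2)`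
(`−1` acts trivially). [folklore] -/
theorem modularLambda_eq_iff_mem_orbit_closure_T_sq {z₁ z₂ : ℍ} :
    modularLambda (z₁ : ℂ) = modularLambda (z₂ : ℂ) ↔
      z₁ ∈ MulAction.orbit (Subgroup.closure ({T ^ 2, S * T ^ 2 * S⁻¹} : Set SL(2, ℤ))) z₂ := by
  rw [modularLambda_eq_modularLambda_iff]
  constructor
  · rintro ⟨γ, hγ, rfl⟩
    rcases mem_closure_T_sq_or_neg_mem (inv_mem hγ) with h | h
    · refine MulAction.mem_orbit_iff.mpr ⟨⟨γ⁻¹, h⟩, ?_⟩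
      rw [Subgroup.mk_smul, inv_smul_smul]
    · refine MulAction.mem_orbit_iff.mpr ⟨⟨-γ⁻¹, h⟩, ?_⟩
      rw [Subgroup.mk_smul, SL_neg_smul, inv_smul_smul]
  · intro hw
    obtain ⟨w, rfl⟩ := MulAction.mem_orbit_iff.mp hw
    exact ⟨(w : SL(2, ℤ))⁻¹, inv_mem (closure_T_sq_le_Gamma_two w.2),
      by rw [Subgroup.smul_def, inv_smul_smul]⟩

/-! ## `λ : ℍ → ℂ ∖ {0, 1}` is a covering map -/

/-- **`λ : ℍ → ℂ ∖ {0,1}` is the quotient covering map of the free, properly discontinuous action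
of `Λ = ⟨T², S T² S⁻¹⟩ ≅ F₂` on `ℍ`.** [cite: CalegariDimitrovTang2025, §1 p. 3, §5.1] -/
theorem isQuotientCoveringMap_modularLambda :
    IsQuotientCoveringMap
      (fun z : ℍ ↦ (⟨modularLambda (z : ℂ), fun h ↦
        h.elim (modularLambda_ne_zero z.2) (modularLambda_ne_one z.2)⟩ : ({0, 1}ᶜ : Set ℂ)))
      (Subgroup.closure ({T ^ 2, S * T ^ 2 * S⁻¹} : Set SL(2, ℤ))) := by
  haveI : ContinuousConstSMul (Subgroup.closure ({T ^ 2, S * T ^ 2 * S⁻¹} : Set SL(2, ℤ))) ℍ :=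
    ⟨fun γ ↦ continuous_const_smul
      ((Matrix.SpecialLinearGroup.mapGL ℝ ((γ : SL(2, ℤ))) : GL (Fin 2) ℝ))⟩
  haveI := properlyDiscontinuousSMul_subgroup
    (Subgroup.closure ({T ^ 2, S * T ^ 2 * S⁻¹} : Set SL(2, ℤ)))
  haveI := isCancelSMul_closure_T_sq
  refine Topology.IsQuotientMap.isQuotientCoveringMap_of_properlyDiscontinuousSMul ?_ ?_
  · refine IsOpenMap.isQuotientMap ?_ ?_ ?_
    · have hopen : IsOpen ({0, 1}ᶜ : Set ℂ) :=
        (Set.toFinite ({0, 1} : Set ℂ)).isClosed.isOpen_compl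
      exact (IsOpen.isOpenEmbedding_subtypeVal hopen).isOpenMap_iff.mpr
        isOpenMap_modularLambda_comp_coe
    · exact continuous_modularLambda_comp_coe.subtype_mk _
    · rintro ⟨c, hc⟩
      simp only [Set.mem_compl_iff, Set.mem_insert_iff, Set.mem_singleton_iff, not_or] at hc
      obtain ⟨τ, hτ, hz⟩ := exists_modularLambda_eq hc.1 hc.2
      exact ⟨⟨τ, hτ⟩, Subtype.ext hz⟩
  · intro e₁ e₂
    rw [Subtype.ext_iff]
    exact modularLambda_eq_iff_mem_orbit_closure_T_sq

/-- **The modular function `λ : ℍ → ℂ ∖ {0, 1}` is a covering map** (and `ℍ` is simply connected,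
so it is a universal covering of the twice-punctured plane).
[cite: CalegariDimitrovTang2025, §1 p. 3 and §5.1] -/
theorem isCoveringMap_modularLambda :
    IsCoveringMap (fun z : ℍ ↦ (⟨modularLambda (z : ℂ), fun h ↦
      h.elim (modularLambda_ne_zero z.2) (modularLambda_ne_one z.2)⟩ : ({0, 1}ᶜ : Set ℂ))) :=
  isQuotientCoveringMap_modularLambda.isCoveringMap _ _

/-- `z ↦ λ(z)` is a covering map over `ℂ ∖ {0, 1}`. [cite: CalegariDimitrovTang2025, §1 p. 3] -/
theorem isCoveringMapOn_modularLambda :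
    IsCoveringMapOn (fun z : ℍ ↦ modularLambda (z : ℂ)) ({0, 1}ᶜ : Set ℂ) :=
  .of_isCoveringMap_subtype ((Set.toFinite ({0, 1} : Set ℂ)).isClosed.isOpen_compl) _
    isCoveringMap_modularLambda

/-- `z ↦ λ(z)` is a local homeomorphism `ℍ → ℂ`. [folklore] -/
theorem isLocalHomeomorph_modularLambda :
    IsLocalHomeomorph (fun z : ℍ ↦ modularLambda (z : ℂ)) := by
  have hopen : IsOpen ({0, 1}ᶜ : Set ℂ) := (Set.toFinite ({0, 1} : Set ℂ)).isClosed.isOpen_compl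
  have := isCoveringMap_modularLambda.isLocalHomeomorph
  exact (hopen.isOpenEmbedding_subtypeVal.isLocalHomeomorph).comp this

/-- **Lifting through `λ`.** Every continuous map `f : A → ℂ ∖ {0, 1}` on a simply connected,
locally path-connected space lifts through `λ` to a continuous `F : A → ℍ`, `λ ∘ F = f`, uniquely
once `F(a₀)` is prescribed in the fibre of `f(a₀)`. [folklore] -/
theorem exists_unique_lift_modularLambda {A : Type*} [TopologicalSpace A] [SimplyConnectedSpace A]
    [LocallyPathConnectedSpace A] {f : A → ℂ} (hf : Continuous f) (hf₀ : ∀ a, f a ≠ 0)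
    (hf₁ : ∀ a, f a ≠ 1) (a₀ : A) (z₀ : ℍ) (h₀ : modularLambda (z₀ : ℂ) = f a₀) :
    ∃! F : C(A, ℍ), F a₀ = z₀ ∧ ∀ a, modularLambda (F a : ℂ) = f a := by
  set f' : C(A, ({0, 1}ᶜ : Set ℂ)) :=
    ⟨fun a ↦ ⟨f a, fun h ↦ h.elim (hf₀ a) (hf₁ a)⟩, hf.subtype_mk _⟩ with hf'
  obtain ⟨F, ⟨hF₀, hF⟩, huniq⟩ :=
    isCoveringMap_modularLambda.existsUnique_continuousMap_lifts f' a₀ z₀ (Subtype.ext h₀)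
  refine ⟨F, ⟨hF₀, fun a ↦ ?_⟩, fun G ⟨hG₀, hG⟩ ↦ huniq G ⟨hG₀, ?_⟩⟩
  · have := congrFun hF a
    simpa [hf'] using congrArg Subtype.val this
  · funext a
    exact Subtype.ext (hG a)


end LambdaCovering

end ModularLambda

end Literature.NumberTheory.Automorphic
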